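import Summits.ResolutionOfSingularities.ResolutionOfSingularities.Theorems.PurelyInseparableDim4IsolationCert
import Mathlib.RingTheory.Polynomial.Basic
import Mathlib.Algebra.MvPolynomial.PDeriv
import Mathlib.Algebra.CharP.Two
import HarnessLib

/-!
# [OURS · res-dim4-pi PR-10, part 2] NON-isolation witnesses: a prime strictly between `J_q⁺(F)` and `𝔪₀`,
  the kernel / line form, and idea-3's T-ISO-1 specimen `x₁x₂ + x₁x₃ + x₂x₃ + x₄³` at `p = 2`

Cell `res-dim4-pi` (D-0157 DOOR 2), brick PR-10 of WORD #24 (a), second file (seat `res-dim4-p-3`); sequel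
of `PurelyInseparableDim4IsolationCert.lean` (the positive certificate `𝔪₀ᴺ ≤ J_q⁺(F) + 𝔪₀ᴺ⁺¹ ⇒
IsIsolated q F`).  The census question Q-ISO (WORD #20 (c)) is answered «non-isolated» on almost every
cycle-entry state (idea-6 proxy 2,410 / 2,411; EN-9's classes COORDINATE-ONLY / BLIND-REGULAR /
SINGULAR-COMPONENT); this file is the kernel tool for THAT side: to refute `PIDim4.IsIsolated q F` it is
enough to name ONE prime `P` with `J_q⁺(F) ≤ P ≤ 𝔪₀`, `P ≠ 𝔪₀` — in practice the kernel of a ring map to a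
domain killing the Hasse derivatives, e.g. the restriction to a LINE or a parametrised CURVE through the
origin along which every `D^{(α)}F` (`0 < |α| < q`) vanishes.

## What is proved (field `K`, the frame's `singLocusIdeal / originIdeal / IsIsolated / hasseDeriv`)

* `not_isIsolated_of_prime`: `P` prime, `J_q⁺(F) ≤ P ≤ 𝔪₀`, `P ≠ 𝔪₀` ⇒ `¬ IsIsolated q F` (a minimal prime
  of `J_q⁺(F)` below `P` lies in `𝔪₀` and is not `𝔪₀`; Mathlib `Ideal.exists_minimalPrimes_le`).
* `not_isIsolated_of_ringHom`: the same from a ring map `φ : K[x₁..x₄] → B` to a domain with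
  `φ(D^{(α)}F) = 0` (`0 < |α| < q`), `ker φ ≤ 𝔪₀` (as: `φ g = 0 ⇒ g(0) = 0`) and some `φ(xᵢ) ≠ 0`.
* `eval_zero_aeval_line`, **`not_isIsolated_of_line`**: the LINE witness — a direction `v` with some
  `vᵢ ≠ 0` such that every `D^{(α)}F` (`0 < |α| < q`) vanishes identically on `t ↦ t·v`
  (`aeval (fun k => C (v k) * X)` into `K[t]`); `not_isIsolated_two_of_line`: at `q = 2` it suffices that
  the four partials vanish on the line (via `singLocusIdeal_two`'s generators `hasseDeriv_single_one`).
* **`not_isIsolated_two_idea3Specimen`**: idea-3's T-ISO-1 specimen (STATUS 16:00:23Z)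
  `F = x₁x₂ + x₁x₃ + x₂x₃ + x₄³` over any field of characteristic `2`: `J₂⁺(F) = ⟨x₂+x₃, x₁+x₃, x₁+x₂,
  3x₄²⟩` vanishes on the line `ℓ = {(t, t, t, 0)}`, so the origin is NOT an isolated double point
  (`¬ IsIsolated 2 F`) — the kernel form of the specimen that motivated dropping `F` from `J_q` (WORD #23 (a)).

[OURS · counted 0 · elementary; AI kernel work, weaker than expert review.]  Nothing here is a statement
about resolution of singularities; resolution in dimension `≥ 4` / characteristic `p > 0` is NOT proved by
anything in this file.  Host item (DR-157-C): `stmt-ResolutionOfSingularities-16155`, helper.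
-/

noncomputable section

set_option linter.dupNamespace false -- mandated namespace of this single-conjunct summit

open MvPolynomial Finset
open scoped BigOperators

namespace Summit.ResolutionOfSingularities.ResolutionOfSingularities.Theorems.PIDim4.IsolationCert

/-! ## §1 A prime strictly between `J_q⁺(F)` and `𝔪₀` refutes isolation -/

/-- **Non-isolation from one prime.** If some prime `P` satisfies `J_q⁺(F) ≤ P ≤ 𝔪₀` and `P ≠ 𝔪₀`, the
origin is not an isolated `q`-fold point: a minimal prime of `J_q⁺(F)` below `P` lies inside `𝔪₀` and
cannot be `𝔪₀`. OURS (elementary). [cite: AtiyahMacdonald1969, Ch. 1 (prime ideals; minimal primes, Ex. 1.8)] -/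
theorem not_isIsolated_of_prime {K : Type} [Field K] {q : ℕ} {F : MvPolynomial (Fin 4) K}
    {P : Ideal (MvPolynomial (Fin 4) K)} (hP : P.IsPrime) (hJP : singLocusIdeal q F ≤ P)
    (hPm : P ≤ originIdeal K) (hne : P ≠ originIdeal K) : ¬ IsIsolated q F := by
  rintro ⟨-, hmin⟩
  haveI := hP
  obtain ⟨P', hP', hP'P⟩ := Ideal.exists_minimalPrimes_le hJP
  have h1 : P' = originIdeal K := hmin P' hP' (hP'P.trans hPm)
  exact hne (le_antisymm hPm (h1 ▸ hP'P))

/-- **Kernel form.** A ring map `φ` from `K[x₁..x₄]` to a domain that kills every `D^{(α)}F`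
(`0 < |α| < q`), whose kernel lies in `𝔪₀` (`φ g = 0 ⇒ g(0) = 0`), and which does not kill some variable
`xᵢ`, refutes isolation (`P = ker φ`). OURS (elementary). [cite: AtiyahMacdonald1969, Ch. 1 (prime ideals)] -/
theorem not_isIsolated_of_ringHom {K : Type} [Field K] {q : ℕ} {F : MvPolynomial (Fin 4) K}
    {B : Type*} [CommRing B] [IsDomain B] (φ : MvPolynomial (Fin 4) K →+* B)
    (hJ : ∀ α : Fin 4 →₀ ℕ, 0 < α.degree → α.degree < q → φ (hasseDeriv α F) = 0)
    (h0 : ∀ g : MvPolynomial (Fin 4) K, φ g = 0 → MvPolynomial.eval (0 : Fin 4 → K) g = 0)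
    {i : Fin 4} (hi : φ (X i) ≠ 0) : ¬ IsIsolated q F := by
  refine not_isIsolated_of_prime (P := RingHom.ker φ) (RingHom.ker_isPrime φ) ?_ ?_ ?_
  · unfold singLocusIdeal
    rw [Ideal.span_le]
    rintro _ ⟨α, h0', hq, rfl⟩
    exact (RingHom.mem_ker).mpr (hJ α h0' hq)
  · intro g hg
    unfold originIdeal
    exact (RingHom.mem_ker).mpr (h0 g ((RingHom.mem_ker).mp hg))
  · intro heq
    have hX : (X i : MvPolynomial (Fin 4) K) ∈ RingHom.ker φ := by
      rw [heq]
      unfold originIdeal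
      rw [RingHom.mem_ker, eval_X]
      rfl
    exact hi ((RingHom.mem_ker).mp hX)

/-! ## §2 The LINE witness `t ↦ t·v` -/

/-- Restricting to the line `t ↦ t·v` and then setting `t = 0` is evaluation at the origin.
OURS (bookkeeping). [cite: AtiyahMacdonald1969, Ch. 1 Ex. 1.1 (the ideal (x₁,…,xₙ))] -/
theorem eval_zero_aeval_line {K : Type} [Field K] (v : Fin 4 → K) (g : MvPolynomial (Fin 4) K) :
    Polynomial.eval 0 (MvPolynomial.aeval (fun k => Polynomial.C (v k) * Polynomial.X) g) =
      MvPolynomial.eval (0 : Fin 4 → K) g := by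
  have hcomp : (Polynomial.evalRingHom (0 : K)).comp
      (MvPolynomial.aeval (fun k => Polynomial.C (v k) * Polynomial.X) :
        MvPolynomial (Fin 4) K →ₐ[K] Polynomial K).toRingHom = MvPolynomial.eval (0 : Fin 4 → K) := by
    refine MvPolynomial.ringHom_ext (fun a => ?_) (fun k => ?_)
    · simp
    · simp
  exact congrArg (fun f : MvPolynomial (Fin 4) K →+* K => f g) hcomp

/-- **The LINE witness.** If along some line `t ↦ t·v` through the origin (`vᵢ ≠ 0` for some `i`) every
Hasse derivative `D^{(α)}F`, `0 < |α| < q`, vanishes identically, then the origin is NOT an isolated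
`q`-fold point: the line lies in `V(J_q⁺(F))`. (Kernel of `K[x] → K[t]`, a domain.) OURS (elementary).
[cite: AtiyahMacdonald1969, Ch. 1 (prime ideals)] -/
theorem not_isIsolated_of_line {K : Type} [Field K] {q : ℕ} {F : MvPolynomial (Fin 4) K}
    (v : Fin 4 → K) {i : Fin 4} (hi : v i ≠ 0)
    (hJ : ∀ α : Fin 4 →₀ ℕ, 0 < α.degree → α.degree < q →
      MvPolynomial.aeval (fun k => Polynomial.C (v k) * Polynomial.X) (hasseDeriv α F) = 0) :
    ¬ IsIsolated q F := by
  refine not_isIsolated_of_ringHom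
    (MvPolynomial.aeval (fun k => Polynomial.C (v k) * Polynomial.X) :
      MvPolynomial (Fin 4) K →ₐ[K] Polynomial K).toRingHom (fun α h0 hq => hJ α h0 hq) (fun g hg => ?_)
    (i := i) ?_
  · rw [← eval_zero_aeval_line v g]
    rw [show MvPolynomial.aeval (fun k => Polynomial.C (v k) * Polynomial.X) g = 0 from hg,
      Polynomial.eval_zero]
  · change MvPolynomial.aeval (fun k => Polynomial.C (v k) * Polynomial.X) (X i : MvPolynomial (Fin 4) K) ≠ 0
    rw [MvPolynomial.aeval_X]
    exact mul_ne_zero (Polynomial.C_ne_zero.mpr hi) Polynomial.X_ne_zero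

/-- **`q = 2` line witness**: it suffices that the four partial derivatives vanish on the line
(`J₂⁺(F) = ⟨∂ᵢF⟩`, `hasseDeriv_single_one`). OURS (elementary). [cite: Giraud1975, §1 (Hasse–Schmidt derivations)] -/
theorem not_isIsolated_two_of_line {K : Type} [Field K] {F : MvPolynomial (Fin 4) K} (v : Fin 4 → K)
    {i : Fin 4} (hi : v i ≠ 0)
    (hJ : ∀ k : Fin 4,
      MvPolynomial.aeval (fun k => Polynomial.C (v k) * Polynomial.X) (pderiv k F) = 0) :
    ¬ IsIsolated 2 F := by
  refine not_isIsolated_of_line v hi fun α h0 h2 => ?_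
  obtain ⟨k, rfl⟩ := exists_eq_single_of_degree_eq_one (γ := α) (by omega)
  rw [hasseDeriv_single_one]
  exact hJ k

/-! ## §3 Specimen: idea-3's T-ISO-1 polynomial is NOT isolated at `p = 2` -/

/-- **idea-3's T-ISO-1 specimen** (cell STATUS 16:00:23Z; the example behind WORD #23 (a)): over any field
of characteristic `2`, `F = x₁x₂ + x₁x₃ + x₂x₃ + x₄³` has `∂F = (x₂ + x₃, x₁ + x₃, x₁ + x₂, 3x₄²)`, all
vanishing on the line `ℓ = {(t, t, t, 0)}` (`t + t = 0`), so `¬ IsIsolated 2 F`: the double-point locus of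
`z² + F` contains the regular NON-coordinate curve over `ℓ` that no coordinate rule sees.
OURS (kernel form of the cell's specimen; census value only). [cite: Giraud1975, §1 (Hasse–Schmidt derivations)] -/
theorem not_isIsolated_two_idea3Specimen {K : Type} [Field K] [CharP K 2] :
    ¬ IsIsolated 2 (X 0 * X 1 + X 0 * X 2 + X 1 * X 2 + X 3 ^ 3 : MvPolynomial (Fin 4) K) := by
  refine not_isIsolated_two_of_line (fun k => if k = 3 then 0 else 1) (i := 0) (by simp) fun k => ?_
  have h2 : ∀ P : Polynomial K, P + P = 0 := fun P => CharTwo.add_self_eq_zero P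
  fin_cases k <;>
    simp [map_add, map_mul, (pderiv _).leibniz_pow, pderiv_X, h2]

end Summit.ResolutionOfSingularities.ResolutionOfSingularities.Theorems.PIDim4.IsolationCert

end
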